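import Summits.Parity.BatemanHorn.Theorems.AlmostPrimeZerosSystemLSDRealSegmentNairWeights
import Summits.Parity.BatemanHorn.Theorems.AlmostPrimeZerosSystemLSDRealSegmentNairLocal
import HarnessLib

/-!
# Nair–Tenenbaum light, IV: Hall–Tenenbaum majorants for `u = G·ρ·h` and `G·ρ`

Crux `SystemLSDRealSegment` (stmt-Parity-11292, route `AlmostPrimeZeros`), line `beta-thinned-root-kernel`,
support programme of the lead c8: **Nair–Tenenbaum "light"** — the sharp-order upper bound
`Σ_{1≤n≤N} G(F(n)) ≤ C · N · exp(Σ_{p≤N} (G(p) − 1) ρ_F(p)/p)` for a polynomial `F ∈ ℤ[X]` (degree `≥ 1`, positive on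
`ℕ_{≥1}`, root counts `ρ_F(p) ≤ D`, `ρ_F(p) < p`, `ρ_F(p^a) ≤ M`) and every weight `G ≥ 0`, `G(1) = 1`, multiplicative on
coprime arguments with `G(p^v) ≤ A` (M. Nair, Acta Arith. 62 (1992); Nair–Tenenbaum, Acta Math. 180 (1998), Thm 1 —
the special case of the class bounded at prime powers), by Shiu's method (J. reine angew. Math. 313 (1980), §5) run on the
values `m = F(n)`: cut `m = c·d` at `√N` (`Shiu.cutPrime/cPart/dPart`), four classes, the beta upper-bound sieve of dimension
`2D` on the root classes of `c`, Hall–Tenenbaum's Theorem 01 and Rankin's trick with a uniform exponent for the `c`-sums.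
Applied (file `…NairUpperBound`) to the product polynomial of a Bateman–Horn system with `G = y^{capped}` it gives
`Σ_{n≤x} y^{s_f(n)} ≪ x (log x)^{k(y−1)}`, i.e. `H_x(y) = O(1)` on the real segment — the upper half of the order of
magnitude predicted by the crux (lower half: `sumPowStat_lower_bound`, landed).  Everything here is PROVED; no definitions.

This file: `Σ_{c≤Z} u(c)/c ≤ exp(K + Σ_{p≤Z} G(p)ρ(p)/p)` and `Σ_{c≤Z} G(c)ρ(c) ≤ Z exp(AM + AD(log log Z + 4))`.
-/

open Finset Real Polynomial

namespace Summit.Parity.BatemanHorn.Cruxes.SystemLSDRealSegment.BetaThinnedRootKernel.Nair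

open Literature.NumberTheory.Sieve

noncomputable section

/-! ## Part C. Euler-product majorants (Hall–Tenenbaum / Rankin) and the Mertens window -/

section Euler

variable (F : ℤ[X]) {D M : ℕ} {G : ℕ → ℝ} {A : ℝ}

/-- `∑_{p ∈ s} 1/p² ≤ 1` over a finite set of primes (from `∑_{p ≤ X} 1/(p(p-1)) ≤ 1`). [folklore] -/
theorem sum_primes_inv_sq_le_one {s : Finset ℕ} (hs : ∀ p ∈ s, p.Prime) :
    ∑ p ∈ s, 1 / (p : ℝ) ^ 2 ≤ 1 := by
  have hsub : s ⊆ Nat.primesLE (s.sup id) := fun p hp =>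
    Nat.mem_primesLE.2 ⟨Finset.le_sup (f := id) hp, hs p hp⟩
  calc ∑ p ∈ s, 1 / (p : ℝ) ^ 2 ≤ ∑ p ∈ Nat.primesLE (s.sup id), 1 / (p : ℝ) ^ 2 :=
        Finset.sum_le_sum_of_subset_of_nonneg hsub fun p _ _ => by positivity
    _ ≤ ∑ p ∈ Nat.primesLE (s.sup id), 1 / ((p : ℝ) * (p - 1)) := by
        refine Finset.sum_le_sum fun p hp => ?_
        have hp2 : (2 : ℝ) ≤ p := by exact_mod_cast (Nat.prime_of_mem_primesLE hp).two_le
        exact one_div_le_one_div_of_le (by nlinarith) (by nlinarith)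
    _ ≤ 1 := Literature.NumberTheory.LFunctions.HallTenenbaum.sum_primesLE_inv_mul_pred_le_one _

/-- Properties of `u = G·ρ·h`: `u(1) = 1`, `u ≥ 0`, multiplicativity on coprime arguments,
`u(p^ν) ≤ A M (4D+2)`, `u(p) ≤ A D (4D+2)` and `u(p)/p ≤ G(p)ρ(p)/p + A(4D+2)D²/p²` at primes. [folklore] -/
theorem u_props (hD : ∀ p : ℕ, p.Prime → polyRootCountMod ![F] p ≤ D)
    (hfix : ∀ p : ℕ, p.Prime → polyRootCountMod ![F] p < p)
    (hM : ∀ p : ℕ, p.Prime → ∀ a : ℕ, 1 ≤ a → polyRootCountMod ![F] (p ^ a) ≤ M)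
    (hG0 : ∀ n, 0 ≤ G n) (hG1 : G 1 = 1) (hGmul : ∀ m n : ℕ, m.Coprime n → G (m * n) = G m * G n)
    (hGA : ∀ p : ℕ, p.Prime → ∀ v : ℕ, 1 ≤ v → G (p ^ v) ≤ A) (hA : 1 ≤ A) {u : ℕ → ℝ}
    (hu : ∀ c, u c = G c * polyRootCountMod ![F] c *
      ∏ p ∈ c.primeFactors, (p : ℝ) / ((p : ℝ) - polyRootCountMod ![F] p)) :
    u 1 = 1 ∧ (∀ n, 0 ≤ u n) ∧ (∀ m n : ℕ, m.Coprime n → u (m * n) = u m * u n) ∧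
      (∀ p : ℕ, p.Prime → ∀ ν : ℕ, 1 ≤ ν → u (p ^ ν) ≤ A * M * (4 * D + 2)) ∧
      (∀ p : ℕ, p.Prime → u p ≤ A * D * (4 * D + 2)) ∧
      (∀ p : ℕ, p.Prime → u p / p ≤
        G p * polyRootCountMod ![F] p / p + A * (4 * D + 2) * D ^ 2 * (1 / (p : ℝ) ^ 2)) := by
  have hA0 : 0 ≤ A := by linarith
  have hD0 : (0 : ℝ) ≤ D := Nat.cast_nonneg D
  have hρ1 : polyRootCountMod ![F] 1 = 1 := by rw [polyRootCountMod_single]; simp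
  have hu1 : u 1 = 1 := by
    rw [hu 1, hG1, hρ1, Nat.primeFactors_one, Finset.prod_empty]; simp
  -- values at a prime
  have hup : ∀ p : ℕ, p.Prime → u p = G p * polyRootCountMod ![F] p *
      ((p : ℝ) / ((p : ℝ) - polyRootCountMod ![F] p)) := by
    intro p hp
    have hh := hLoc_prime_pow F hp (le_refl 1)
    rw [pow_one] at hh
    rw [hu p, hh]
  have hGp : ∀ p : ℕ, p.Prime → G p ≤ A := fun p hp => by
    have := hGA p hp 1 le_rfl
    rwa [pow_one] at this
  refine ⟨hu1, fun n => ?_, fun m n hmn => ?_, fun p hp ν hν => ?_, fun p hp => ?_, fun p hp => ?_⟩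
  · rw [hu n]
    exact mul_nonneg (mul_nonneg (hG0 n) (Nat.cast_nonneg _))
      (zero_le_one.trans (one_le_hLoc F hD hfix n))
  · rcases eq_or_ne m 0 with rfl | hm
    · have hn1 : n = 1 := by simpa using hmn
      subst hn1
      rw [zero_mul, hu1, mul_one]
    rcases eq_or_ne n 0 with rfl | hn
    · have hm1 : m = 1 := by simpa using hmn
      subst hm1
      rw [mul_zero, hu1, one_mul]
    rw [hu (m * n), hu m, hu n, hGmul m n hmn, polyRootCountMod_mul_of_coprime F hmn, Nat.cast_mul,
      hLoc_mul F hm hn hmn]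
    ring
  · obtain ⟨hθ1, hθ2, -⟩ := theta_bounds F hD hfix hp
    rw [hu (p ^ ν), hLoc_prime_pow F hp hν]
    have h1 : G (p ^ ν) ≤ A := hGA p hp ν hν
    have h2 : (polyRootCountMod ![F] (p ^ ν) : ℝ) ≤ M := by exact_mod_cast hM p hp ν hν
    exact mul_le_mul (mul_le_mul h1 h2 (Nat.cast_nonneg _) hA0) hθ2 (by linarith)
      (mul_nonneg hA0 (Nat.cast_nonneg _))
  · obtain ⟨hθ1, hθ2, -⟩ := theta_bounds F hD hfix hp
    rw [hup p hp]
    have h2 : (polyRootCountMod ![F] p : ℝ) ≤ D := by exact_mod_cast hD p hp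
    exact mul_le_mul (mul_le_mul (hGp p hp) h2 (Nat.cast_nonneg _) hA0) hθ2 (by linarith)
      (mul_nonneg hA0 hD0)
  · obtain ⟨hθ1, -, hθ3⟩ := theta_bounds F hD hfix hp
    rw [hup p hp]
    set t := (p : ℝ) / ((p : ℝ) - polyRootCountMod ![F] p) with ht
    set r := (polyRootCountMod ![F] p : ℝ) with hr
    have hp0 : (0 : ℝ) < p := by exact_mod_cast hp.pos
    have h2 : r ≤ D := by rw [hr]; exact_mod_cast hD p hp
    have hr0 : 0 ≤ r := Nat.cast_nonneg _
    have key : G p * r * (t - 1) ≤ A * D * ((4 * D + 2) * D / p) := by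
      calc G p * r * (t - 1) ≤ A * D * (t - 1) :=
            mul_le_mul_of_nonneg_right (mul_le_mul (hGp p hp) h2 hr0 hA0) (by linarith)
        _ ≤ A * D * ((4 * D + 2) * r / p) := mul_le_mul_of_nonneg_left hθ3 (mul_nonneg hA0 hD0)
        _ ≤ A * D * ((4 * D + 2) * D / p) := by
            refine mul_le_mul_of_nonneg_left ?_ (mul_nonneg hA0 hD0)
            exact div_le_div_of_nonneg_right (mul_le_mul_of_nonneg_left h2 (by positivity)) hp0.le
    have e1 : G p * r * t / p = G p * r / p + G p * r * (t - 1) / p := by ring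
    have e2 : A * D * ((4 * D + 2) * D / p) / p = A * (4 * D + 2) * D ^ 2 * (1 / (p : ℝ) ^ 2) := by
      field_simp
    rw [e1, ← e2]
    exact add_le_add le_rfl (div_le_div_of_nonneg_right key hp0.le)

/-- `∑_{p ∈ s} u(p)/p ≤ ∑_{p ∈ s} G(p)ρ(p)/p + A(4D+2)D²` over a finite set `s` of primes. [folklore] -/
theorem sum_u_prime_div_le (hD : ∀ p : ℕ, p.Prime → polyRootCountMod ![F] p ≤ D)
    (hfix : ∀ p : ℕ, p.Prime → polyRootCountMod ![F] p < p)
    (hM : ∀ p : ℕ, p.Prime → ∀ a : ℕ, 1 ≤ a → polyRootCountMod ![F] (p ^ a) ≤ M)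
    (hG0 : ∀ n, 0 ≤ G n) (hG1 : G 1 = 1) (hGmul : ∀ m n : ℕ, m.Coprime n → G (m * n) = G m * G n)
    (hGA : ∀ p : ℕ, p.Prime → ∀ v : ℕ, 1 ≤ v → G (p ^ v) ≤ A) (hA : 1 ≤ A) {u : ℕ → ℝ}
    (hu : ∀ c, u c = G c * polyRootCountMod ![F] c *
      ∏ p ∈ c.primeFactors, (p : ℝ) / ((p : ℝ) - polyRootCountMod ![F] p))
    {s : Finset ℕ} (hs : ∀ p ∈ s, p.Prime) :
    ∑ p ∈ s, u p / p ≤ ∑ p ∈ s, G p * polyRootCountMod ![F] p / p + A * (4 * D + 2) * D ^ 2 := by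
  obtain ⟨-, -, -, -, -, hdiv⟩ := u_props F hD hfix hM hG0 hG1 hGmul hGA hA hu
  have hA0 : 0 ≤ A := by linarith
  have hC : 0 ≤ A * (4 * D + 2) * (D : ℝ) ^ 2 := by positivity
  calc ∑ p ∈ s, u p / p
      ≤ ∑ p ∈ s, (G p * polyRootCountMod ![F] p / p + A * (4 * D + 2) * D ^ 2 * (1 / (p : ℝ) ^ 2)) :=
        Finset.sum_le_sum fun p hp => hdiv p (hs p hp)
    _ = ∑ p ∈ s, G p * polyRootCountMod ![F] p / p + A * (4 * D + 2) * D ^ 2 * ∑ p ∈ s, 1 / (p : ℝ) ^ 2 := by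
        rw [Finset.sum_add_distrib, ← Finset.mul_sum]
    _ ≤ ∑ p ∈ s, G p * polyRootCountMod ![F] p / p + A * (4 * D + 2) * D ^ 2 * 1 := by
        have := sum_primes_inv_sq_le_one hs
        gcongr
    _ = _ := by ring

/-- **Logarithmic mean of `u = G·ρ·h`.** `Σ_{c ≤ Z} u(c)/c ≤ exp(K + Σ_{p ≤ Z} G(p)ρ(p)/p)` with
`K = A M (4D+2) + A (4D+2) D²`. [folklore] -/
theorem sum_u_div_le (hD : ∀ p : ℕ, p.Prime → polyRootCountMod ![F] p ≤ D) (hD1 : 1 ≤ D)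
    (hfix : ∀ p : ℕ, p.Prime → polyRootCountMod ![F] p < p)
    (hM : ∀ p : ℕ, p.Prime → ∀ a : ℕ, 1 ≤ a → polyRootCountMod ![F] (p ^ a) ≤ M) (hM1 : 1 ≤ M)
    (hG0 : ∀ n, 0 ≤ G n) (hG1 : G 1 = 1) (hGmul : ∀ m n : ℕ, m.Coprime n → G (m * n) = G m * G n)
    (hGA : ∀ p : ℕ, p.Prime → ∀ v : ℕ, 1 ≤ v → G (p ^ v) ≤ A) (hA : 1 ≤ A) (Z : ℕ) :
    ∑ c ∈ Icc 1 Z, G c * polyRootCountMod ![F] c *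
        (∏ p ∈ c.primeFactors, (p : ℝ) / ((p : ℝ) - polyRootCountMod ![F] p)) / c ≤
      Real.exp (A * M * (4 * D + 2) + A * (4 * D + 2) * D ^ 2 +
        ∑ p ∈ Nat.primesLE Z, G p * polyRootCountMod ![F] p / p) := by
  have _hD1 := hD1
  set u : ℕ → ℝ := fun c => G c * polyRootCountMod ![F] c *
    ∏ p ∈ c.primeFactors, (p : ℝ) / ((p : ℝ) - polyRootCountMod ![F] p) with hu
  have hu' : ∀ c, u c = G c * polyRootCountMod ![F] c *
      ∏ p ∈ c.primeFactors, (p : ℝ) / ((p : ℝ) - polyRootCountMod ![F] p) := fun c => rfl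
  obtain ⟨hu1, hu0, humul, hupow, -, -⟩ := u_props F hD hfix hM hG0 hG1 hGmul hGA hA hu'
  have hA0 : 0 ≤ A := by linarith
  have hM1' : (1 : ℝ) ≤ M := by exact_mod_cast hM1
  have hD0 : (0 : ℝ) ≤ D := Nat.cast_nonneg D
  have hK : (1 : ℝ) ≤ A * M * (4 * D + 2) := by
    calc (1 : ℝ) ≤ A := hA
      _ ≤ A * M := le_mul_of_one_le_right hA0 hM1'
      _ ≤ A * M * (4 * D + 2) := le_mul_of_one_le_right (by positivity) (by linarith)
  have hHT := HallTenenbaum.sum_div_le_exp_of_le hu1 humul hu0 hK hupow Z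
  have hsum := sum_u_prime_div_le F hD hfix hM hG0 hG1 hGmul hGA hA hu'
    (s := Nat.primesLE Z) (fun p hp => Nat.prime_of_mem_primesLE hp)
  show ∑ c ∈ Icc 1 Z, u c / c ≤ _
  refine hHT.trans (Real.exp_le_exp.2 ?_)
  linarith

/-- **Plain mean of `G·ρ`.** `Σ_{c ≤ Z} G(c)ρ(c) ≤ Z · exp(A M + A D (log log Z + 4))` for `Z ≥ 2`. [folklore] -/
theorem sum_Grho_le (hD : ∀ p : ℕ, p.Prime → polyRootCountMod ![F] p ≤ D)
    (hM : ∀ p : ℕ, p.Prime → ∀ a : ℕ, 1 ≤ a → polyRootCountMod ![F] (p ^ a) ≤ M) (hM1 : 1 ≤ M)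
    (hG0 : ∀ n, 0 ≤ G n) (hG1 : G 1 = 1) (hGmul : ∀ m n : ℕ, m.Coprime n → G (m * n) = G m * G n)
    (hGA : ∀ p : ℕ, p.Prime → ∀ v : ℕ, 1 ≤ v → G (p ^ v) ≤ A) (hA : 1 ≤ A) {Z : ℕ} (hZ : 2 ≤ Z) :
    ∑ c ∈ Icc 1 Z, G c * polyRootCountMod ![F] c ≤
      Z * Real.exp (A * M + A * D * (Real.log (Real.log Z) + 4)) := by
  set f : ℕ → ℝ := fun c => G c * polyRootCountMod ![F] c with hf
  have hA0 : 0 ≤ A := by linarith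
  have hD0 : (0 : ℝ) ≤ D := Nat.cast_nonneg D
  have hρ1 : polyRootCountMod ![F] 1 = 1 := by rw [polyRootCountMod_single]; simp
  have hf1 : f 1 = 1 := by simp [hf, hG1, hρ1]
  have hf0 : ∀ n, 0 ≤ f n := fun n => mul_nonneg (hG0 n) (Nat.cast_nonneg _)
  have hfmul : ∀ m n : ℕ, m.Coprime n → f (m * n) = f m * f n := by
    intro m n hmn
    simp only [hf, hGmul m n hmn, polyRootCountMod_mul_of_coprime F hmn, Nat.cast_mul]
    ring
  have hM1' : (1 : ℝ) ≤ M := by exact_mod_cast hM1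
  have hK : (1 : ℝ) ≤ A * M := hA.trans (le_mul_of_one_le_right hA0 hM1')
  have hfK : ∀ p : ℕ, p.Prime → ∀ ν : ℕ, 1 ≤ ν → f (p ^ ν) ≤ A * M := by
    intro p hp ν hν
    simp only [hf]
    exact mul_le_mul (hGA p hp ν hν) (by exact_mod_cast hM p hp ν hν) (Nat.cast_nonneg _) hA0
  have hHT := HallTenenbaum.sum_div_le_exp_of_le hf1 hfmul hf0 hK hfK Z
  -- `∑ f(c) ≤ Z ∑ f(c)/c`
  have h1 : ∑ c ∈ Icc 1 Z, f c ≤ Z * ∑ c ∈ Icc 1 Z, f c / c := by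
    rw [Finset.mul_sum]
    refine Finset.sum_le_sum fun c hc => ?_
    obtain ⟨hc1, hcZ⟩ := Finset.mem_Icc.1 hc
    have hc0 : (0 : ℝ) < c := by exact_mod_cast hc1
    have hcZ' : (c : ℝ) ≤ Z := by exact_mod_cast hcZ
    calc f c = c * (f c / c) := by field_simp
      _ ≤ Z * (f c / c) := mul_le_mul_of_nonneg_right hcZ' (div_nonneg (hf0 c) hc0.le)
  -- the prime sum
  have h2 : ∑ p ∈ Nat.primesLE Z, f p / p ≤ A * D * (Real.log (Real.log Z) + 4) := by
    have hmert := Literature.NumberTheory.LFunctions.MertensBound.sum_inv_prime_le Z hZ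
    calc ∑ p ∈ Nat.primesLE Z, f p / p ≤ ∑ p ∈ Nat.primesLE Z, A * D * (1 / (p : ℝ)) := by
          refine Finset.sum_le_sum fun p hp => ?_
          have hpp := Nat.prime_of_mem_primesLE hp
          have hp0 : (0 : ℝ) < p := by exact_mod_cast hpp.pos
          rw [mul_one_div]
          refine div_le_div_of_nonneg_right ?_ hp0.le
          simp only [hf]
          have hGp : G p ≤ A := by
            have := hGA p hpp 1 le_rfl
            rwa [pow_one] at this
          exact mul_le_mul hGp (by exact_mod_cast hD p hpp) (Nat.cast_nonneg _) hA0
      _ = A * D * ∑ p ∈ Nat.primesLE Z, 1 / (p : ℝ) := by rw [Finset.mul_sum]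
      _ ≤ A * D * (Real.log (Real.log Z) + 4) := mul_le_mul_of_nonneg_left hmert (mul_nonneg hA0 hD0)
  have hZ0 : (0 : ℝ) ≤ Z := Nat.cast_nonneg Z
  calc ∑ c ∈ Icc 1 Z, G c * (polyRootCountMod ![F] c : ℝ) = ∑ c ∈ Icc 1 Z, f c := rfl
    _ ≤ Z * ∑ c ∈ Icc 1 Z, f c / c := h1
    _ ≤ Z * Real.exp (A * M + ∑ p ∈ Nat.primesLE Z, f p / p) := mul_le_mul_of_nonneg_left hHT hZ0
    _ ≤ Z * Real.exp (A * M + A * D * (Real.log (Real.log Z) + 4)) :=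
        mul_le_mul_of_nonneg_left (Real.exp_le_exp.2 (by linarith)) hZ0

end Euler

/-- **Registered form** (`--supports stmt-Parity-11292`): Hall–Tenenbaum logarithmic mean of `u = G·ρ·h`. [folklore] -/
theorem nair_sum_u_div_le : ∀ (F : ℤ[X]) (D M : ℕ) (G : ℕ → ℝ) (A : ℝ), (∀ p : ℕ, p.Prime → polyRootCountMod ![F] p ≤ D) → 1 ≤ D → (∀ p : ℕ, p.Prime → polyRootCountMod ![F] p < p) → (∀ p : ℕ, p.Prime → ∀ a : ℕ, 1 ≤ a → polyRootCountMod ![F] (p ^ a) ≤ M) → 1 ≤ M → (∀ n, 0 ≤ G n) → G 1 = 1 → (∀ m n : ℕ, m.Coprime n → G (m * n) = G m * G n) → (∀ p : ℕ, p.Prime → ∀ v : ℕ, 1 ≤ v → G (p ^ v) ≤ A) → 1 ≤ A → ∀ Z : ℕ, ∑ c ∈ Icc 1 Z, G c * polyRootCountMod ![F] c * (∏ p ∈ c.primeFactors, (p : ℝ) / ((p : ℝ) - polyRootCountMod ![F] p)) / c ≤ Real.exp (A * M * (4 * D + 2) + A * (4 * D + 2) * D ^ 2 + ∑ p ∈ Nat.primesLE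 Z, G p * polyRootCountMod ![F] p / p) :=
  fun F _D _M _G _A hD hD1 hfix hM hM1 hG0 hG1 hGmul hGA hA Z => sum_u_div_le F hD hD1 hfix hM hM1 hG0 hG1 hGmul hGA hA Z

end

end Summit.Parity.BatemanHorn.Cruxes.SystemLSDRealSegment.BetaThinnedRootKernel.Nair
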